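import Literature.NumberTheory.EllipticCurves.PAdicLFunctionMinus
import Literature.NumberTheory.EllipticCurves.PAdicLFunctionNeZeroProofs
import Literature.NumberTheory.EllipticCurves.Greenberg1999.TwoTorsionMuInvariant
import Literature.NumberTheory.EllipticCurves.Rank1Residual.Predicates
import HarnessLib

/-!
# Cell `bsd-f1-sign2` (`p = 2`, non-CM) — IMC lens g1: the RHOMBIC SYMBOL CONGRUENCE
# `[a/2^m]⁺ − [a/2^m]⁻ ≡ [1/2]⁺ (mod ℤ)` (candidate IMC-A♮sym, theorem-grade) and its finite-layer form
# `θ⁺_n − θ⁻_n ≡ [1/2]⁺·ν_n (mod ℤ[T])` (IMC-LAYER, every reduction type, supersingular `2` included)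

HONEST FRAMING (typer seat `bsd-f1-sign2-ty`; HOME `run/shared/lean/pub/bsd-f1-sign2/`, CANDIDATES.md §2
rows IMC-A♮sym / IMC-LAYER): STATEMENTS ONLY — predicates with bodies (`IsRhombic`,
`PlusMinusSymbolCongruenceAtTwo`, `layerPlus`, `layerMinus`, `layerNorm`, `LayerCongruenceAtTwo`), three
`@[conjecture] def`s (OPEN obligations of ours: `RhombicSymbolCongruence` = THEOREM-GRADE per the planner,
support `RhombicOfNegDisc`, curve-level `SupersingularLayerCongruenceAtTwo`) and PROVED glue
(`layerCongruence_of_symbolCongruence`, `supersingularLayerCongruence_of_rhombic`); nothing asserted,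
no named fact, PARTITION: none moved. Source: planner-of-record g1 sketch `HOME/MEMO-imc-data/Sketch.lean`
sha16 fc83a7cf575bfb34 §§1–3 (`lean check` rc 0), bodies re-filed VERBATIM (namespace already
`Summit.BirchSwinnertonDyer.Rank1Residual.F1Sign2`). REFUTER PASS: REF1-AUDIT-v1.md §8.3 (batch 2, 2026-08-27T15:06Z, file sha16 e1bf27aeee759c96): every closed Prop of this file **SURVIVES** (9/9 -imc v2, A1 rc 0, BC7 LIBRARY-SEARCH-ON CLEAN; REF1 CONCURS A♮-sym / A♮-L are THEOREM-GRADE with the tree's normalisations, `RhombicOfNegDisc` and `MultPackageIsPlusBranch` support-grade TRUE, K2μ = THE open crux; typing suggestion non-blocking: on `GoodSS W 2` the 2-torsion binder is redundant, §8.4). REF2 on the v2 rows: pending at filing.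

THE g1 SHARPENING OF THE LENS ANSWER (MEMO-imc v2 §1): the «± object at 2» is the index-`2` gluing of the
period lattice `Λ_f` along its real and imaginary projections — for a RHOMBIC `Λ_f` (`Δ(E_f) < 0`, `E_f(ℝ)`
connected) the plus and minus modular symbols at every cusp `a/2^m` (`a` odd, `m ≥ 1`, `4 ∤ N`) satisfy the
EXACT congruence `[r]⁺ − [r]⁻ ≡ [1/2]⁺ (mod ℤ)` (MECHANISM: `{∞,a/2^m} − {∞,1/2} ∈ Λ_f` for `4 ∤ N` — the
cusp-class lemma `modularSymbol_div_sub_half_mem_periodLattice` — `{∞,1/2}` is real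
(`im_modularSymbol_half`), and for `λ = xω₁ + y(ω₁/2 + ih) ∈ Λ_f` rhombic `re λ/Ω⁺ = x + y/2`,
`im λ/Ω⁻ = ±y/2`; missing piece = the rhombic lattice algebra, M-sized), with NO torsion / irreducibility
hypothesis; at finite layers `θ⁺_n − θ⁻_n − [1/2]⁺·ν_n ∈ ℤ[T]` for EVERY `n` and every reduction type
(so also at supersingular `2`, feeding the `-desc`/`-an` ♯/♭ questions). The `L`-function form (mod `2Λ₂`)
and the open analytic `μ = 0` crux are in the sibling file `F1Sign2/BranchCongruenceModTwoAtTwo.lean`.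

BC5 WITNESS (ENGINE D2 = kit j280798, 679 curves `N ≤ 2·10⁴`, exact arithmetic; scripts + outputs
`HOME/MEMO-imc-data/` falsifier_d2.py / lattice_index_d2.py / layer_test_d2.py, SHA16SUMS there; `2`-torsion
flags exact via tors2.py a78d8e887b22da09): (T1 = A♮sym in PARI coordinates) `frac(x⁺(a/2^m) − x⁻(a/2^m))`
constant over all odd `a`, `2 ≤ m ≤ 6`: **415/420** `Δ<0 ∧ E[2](ℚ)=0` rows (26 040 symbol pairs; the 5
failures 7094c3, 17603a3, 304btw-1, 832gtw-2, 432etw-1 are non-`Λ_f` models — period-lattice generator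
scale `(1/3, 1)`, rescued by `frac(3x⁺ − x⁻)` constant, `λ⁺ = λ⁻`); (T4 = `LayerCongruenceAtTwo` exact,
`n ≤ 5`) `S⁺_n − S⁻_n − c·ν_n ∈ ℤ[X]`: **2490/2490 layers on 415 rows, 0 failures** (+306/306 on 51 `Δ<0`
rows with `2`-torsion); (normalisation-free ± object) lattice index `i(M) = [M : M∩ℝ ⊕ M∩iℝ]` of the
ℤ-span of symbol pairs: **`i = 2` on 420/420 `Δ<0` torsion-free rows vs `i = 1` on 146/146 `Δ>0`
torsion-free rows** (perfect separation). CHEAPEST FALSIFIER: one `Δ<0`, `E[2](ℚ)=0`, `Λ_f`-model row with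
`frac(x⁺ − x⁻)` non-constant, or one non-integral layer coefficient — **0/415, 0/2490: NOT KILLED**.
WHY NOVEL (MEMO-imc §6 / v2 §1): the cross-branch congruence at `2` (the analytic Kida formula for the twist
by `−1`, which at `2` has no odd prime and no local terms) is not in print; REF2 v2: NOVEL-AS-STATED at 2
for the A-family (algebraic λ-twin = Matsuno 2008 Thm 5.1).

References: [MazurTateTeitelbaum1986Invent] §I.8 (the symbols `[a/m]^±`), §I.13 (`p = 2`); [Manin1972]
Cor. 3.6 (cusp classes); HOME MEMO-imc.md, MEMO-imc-data/Sketch.lean fc83a7cf575bfb34, REF1-AUDIT-v1.md,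
REF2-PLACEMENT-v2.md.
-/

set_option autoImplicit false

noncomputable section

open scoped Classical MatrixGroups ModularForm

open CongruenceSubgroup Polynomial WeierstrassCurve Literature.NumberTheory.EllipticCurves
  Literature.NumberTheory.EllipticCurves.ModularForms Literature.NumberTheory.EllipticCurves.Greenberg1999
  Literature.NumberTheory.EllipticCurves.Rank1Residual

namespace Summit.BirchSwinnertonDyer.Rank1Residual.F1Sign2

/-! ## §1. The rhombic symbol congruence (IMC-A♮sym) -/

/-- **`Λ_f` is RHOMBIC** (non-rectangular): some period has its real part outside `Λ_f`. For a
conjugation-stable rank-2 lattice this says `re Λ_f ≠ Λ_f ∩ ℝ`, i.e. `Λ_f = ℤω₁ ⊕ ℤ(ω₁/2 + ih)`,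
i.e. `E_f(ℝ)` is connected, i.e. `Δ(E_f) < 0` for the optimal curve `E_f = ℂ/Λ_f` (and for every
curve of the isogeny class when the class has no rational `2`-torsion). Intrinsic to `f`. A DEFINITION
(predicate on `f`); nothing asserted. [folklore] -/
def IsRhombic {N : ℕ} (f : CuspForm (Gamma0 N) 2) : Prop :=
  ∃ z ∈ periodLattice f, ((z.re : ℂ)) ∉ periodLattice f

/-- **A♮ (symbol level) — the plus/minus congruence at cusps of `2`-power denominator** (predicate on
`f`): for every odd `a` and `m ≥ 1`, `[a/2^m]⁺_f − [a/2^m]⁻_f − [1/2]⁺_f ∈ ℤ` (tree normalisation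
`re Λ_f = ℤ·Ω⁺/2`, `im Λ_f = ℤ·Ω⁻/2`; `ratPlusSymbol`, `ratMinusSymbol`). A DEFINITION; nothing asserted.
[cite: MazurTateTeitelbaum1986Invent, §I.8 (the symbols [a/m]^±; the congruence is ours)] -/
def PlusMinusSymbolCongruenceAtTwo {N : ℕ} (f : CuspForm (Gamma0 N) 2) : Prop :=
  ∀ (a : ℤ) (m : ℕ), Odd a → 1 ≤ m →
    ∃ k : ℤ, ratPlusSymbol f ((a : ℚ) / 2 ^ m) - ratMinusSymbol f ((a : ℚ) / 2 ^ m) =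
      ratPlusSymbol f (1 / 2) + k

/-- **CANDIDATE IMC-A♮sym `RhombicSymbolCongruence` (THEOREM-GRADE per the planner; cell `bsd-f1-sign2`,
IMC lens g1):** for a normalised newform with rational coefficients, `4 ∤ N` and `Λ_f` rhombic, the
plus/minus symbol congruence holds. In-tree inputs: `modularSymbol_div_sub_half_mem_periodLattice`,
`im_modularSymbol_half`, `isZLattice_periodLattice_holds`, `conj_mem_periodLattice_holds`; missing piece =
the rhombic lattice algebra (M-sized). Witness: T1 415/420 (5 = non-`Λ_f` models), lattice index `2` vs
`1` perfect separation 420/420 vs 146/146. [folklore] -/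
@[conjecture] def RhombicSymbolCongruence : Prop :=
  ∀ ⦃N : ℕ⦄ [NeZero N] (f : CuspForm (Gamma0 N) 2),
    IsNewform0 f → coeffField f = ⊥ → ¬ 4 ∣ N → IsRhombic f → PlusMinusSymbolCongruenceAtTwo f

/-- **Bridge (support) `RhombicOfNegDisc`: `Δ_W < 0` and no rational `2`-torsion ⇒ `Λ_f` rhombic**
(the sign of `Δ` is an invariant of an isogeny class without rational `2`-torsion — all isogenies have
odd degree — and `Λ_f ≃ c_f · Λ(E_f)` with the real Manin constant). [folklore] -/
@[conjecture] def RhombicOfNegDisc : Prop :=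
  ∀ (W : WeierstrassCurve ℚ) [W.IsElliptic] [W.IsGloballyMinimal],
    W.Δ < 0 → (∀ x : ℚ, ¬ HasRationalTwoTorsionX W x) →
    ∀ ⦃N : ℕ⦄ [NeZero N] (f : CuspForm (Gamma0 N) 2), IsNewformOf W f → IsRhombic f

/-! ## §2. Finite layers (every reduction type at an odd level; supersingular `2` included) -/

/-- The level-`n` PLUS layer element over `⟨5⟩ ⊂ (ℤ/2^{n+2})^×`:
`θ⁺_n(f) = ∑_{s < 2ⁿ} [5ˢ/2^{n+2}]⁺_f (1+X)ˢ ∈ ℚ[X]` (half of the tree's `mazurTateElement f 2 n`,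
which also sums over `η = −1`, `Sprung2017.mazurTateElement_two_eq`; `= S⁺_n` of the data seat's ENGINE D2).
[cite: MazurTateTeitelbaum1986Invent, §I.13 (p = 2: Δ = {±1}, γ = 5)] -/
def layerPlus {N : ℕ} (f : CuspForm (Gamma0 N) 2) (n : ℕ) : ℚ[X] :=
  ∑ s ∈ Finset.range (2 ^ n),
    C (ratPlusSymbol f (((5 ^ s % 2 ^ (n + 2) : ℕ) : ℚ) / 2 ^ (n + 2))) * (X + 1) ^ s

/-- The level-`n` MINUS (`ω¹`-weighted) layer element `θ⁻_n(f) = ∑_{s < 2ⁿ} [5ˢ/2^{n+2}]⁻_f (1+X)ˢ`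
(half of the `ω`-odd Mazur–Tate element `∑_{a odd} χ₋₄(a)[a/2^{n+2}]⁻ σ_a` =
`Literature…mazurTateElementOdd f 2 n`, `mazurTateElementOdd_two_eq`; `= S⁻_n` of ENGINE D2).
[cite: MazurTateTeitelbaum1986Invent, §I.13 (p = 2) and §I.8] -/
def layerMinus {N : ℕ} (f : CuspForm (Gamma0 N) 2) (n : ℕ) : ℚ[X] :=
  ∑ s ∈ Finset.range (2 ^ n),
    C (ratMinusSymbol f (((5 ^ s % 2 ^ (n + 2) : ℕ) : ℚ) / 2 ^ (n + 2))) * (X + 1) ^ s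

/-- `ν_n = ∑_{s < 2ⁿ} (1+X)ˢ = ((1+X)^{2ⁿ} − 1)/X` (the norm element of the layer). [folklore] -/
def layerNorm (n : ℕ) : ℚ[X] := ∑ s ∈ Finset.range (2 ^ n), (X + 1) ^ s

/-- **A♮ at finite layers (predicate on `f`):** `θ⁺_n − θ⁻_n − [1/2]⁺·ν_n ∈ ℤ[X]·1` coefficientwise,
i.e. the two layer elements are congruent modulo `ℤ[X]` up to the explicit multiple `[1/2]⁺ ν_n` of the
norm element — for EVERY `n`, with no reduction-type hypothesis (so also at supersingular `2`).
A DEFINITION; nothing asserted. [folklore] -/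
def LayerCongruenceAtTwo {N : ℕ} (f : CuspForm (Gamma0 N) 2) : Prop :=
  ∀ n : ℕ, ∃ P : ℤ[X],
    layerPlus f n - layerMinus f n - C (ratPlusSymbol f (1 / 2)) * layerNorm n =
      Polynomial.map (Int.castRingHom ℚ) P

/-- **CANDIDATE IMC-LAYER `SupersingularLayerCongruenceAtTwo` (curve-level reading for the supersingular
block of the leaf, `GoodSS W 2`, odd level):** `Δ < 0`, no rational `2`-torsion ⇒ the `ω⁰` and `ω¹`
Mazur–Tate towers of the newform agree mod `(ℤ, ν_n)` (`LayerCongruenceAtTwo f`). Follows from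
`RhombicSymbolCongruence ∧ RhombicOfNegDisc` (`supersingularLayerCongruence_of_rhombic`, proved below).
Witness: T4 2490/2490 layers on 415 rows. [folklore] -/
@[conjecture] def SupersingularLayerCongruenceAtTwo : Prop :=
  ∀ (W : WeierstrassCurve ℚ) [W.IsElliptic] [W.IsGloballyMinimal],
    GoodSS W 2 → W.Δ < 0 → (∀ x : ℚ, ¬ HasRationalTwoTorsionX W x) →
    ∀ ⦃N : ℕ⦄ [NeZero N] (f : CuspForm (Gamma0 N) 2), IsNewformOf W f → LayerCongruenceAtTwo f

/-! ## §3. Proved glue -/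

/-- Symbol congruence ⇒ layer congruence (termwise: `5ˢ mod 2^{n+2}` is odd and `n + 2 ≥ 1`).
[cite: MazurTateTeitelbaum1986Invent, §I.13 (p = 2; the bookkeeping is ours)] -/
theorem layerCongruence_of_symbolCongruence {N : ℕ} (f : CuspForm (Gamma0 N) 2)
    (h : PlusMinusSymbolCongruenceAtTwo f) : LayerCongruenceAtTwo f := by
  intro n
  classical
  -- choose the integer for each exponent `s`
  have hk : ∀ s : ℕ, ∃ k : ℤ,
      ratPlusSymbol f (((5 ^ s % 2 ^ (n + 2) : ℕ) : ℚ) / 2 ^ (n + 2)) -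
        ratMinusSymbol f (((5 ^ s % 2 ^ (n + 2) : ℕ) : ℚ) / 2 ^ (n + 2)) =
        ratPlusSymbol f (1 / 2) + k := by
    intro s
    have hodd : Odd ((5 ^ s % 2 ^ (n + 2) : ℕ) : ℤ) := by
      have h5 : Odd (5 ^ s % 2 ^ (n + 2)) := by
        have : (5 ^ s % 2 ^ (n + 2)) % 2 = 1 := by
          rw [Nat.mod_mod_of_dvd _ (dvd_pow_self 2 (by omega))]
          exact Nat.odd_iff.mp (Odd.pow (by decide))
        exact Nat.odd_iff.mpr this
      exact_mod_cast (Int.odd_coe_nat _).mpr h5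
    obtain ⟨k, hk⟩ := h ((5 ^ s % 2 ^ (n + 2) : ℕ) : ℤ) (n + 2) hodd (by omega)
    refine ⟨k, ?_⟩
    have e : (((5 ^ s % 2 ^ (n + 2) : ℕ) : ℤ) : ℚ) = ((5 ^ s % 2 ^ (n + 2) : ℕ) : ℚ) := by push_cast; rfl
    rw [e] at hk
    exact hk
  choose k hk using hk
  refine ⟨∑ s ∈ Finset.range (2 ^ n), Polynomial.C (k s) * (X + 1) ^ s, ?_⟩
  simp only [layerPlus, layerMinus, layerNorm, Polynomial.map_sum, Polynomial.map_mul,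
    Polynomial.map_pow, Polynomial.map_add, Polynomial.map_X, Polynomial.map_one, Polynomial.map_C,
    Finset.mul_sum, ← Finset.sum_sub_distrib]
  refine Finset.sum_congr rfl fun s _ => ?_
  rw [← sub_mul, ← sub_mul, ← Polynomial.C_sub, ← Polynomial.C_sub, hk s]
  simp only [eq_intCast]
  ring

/-- **A♮sym ∧ (Δ<0 ⇒ rhombic) ⇒ IMC-LAYER** on the supersingular block: the newform of a curve good at `2`
has level prime to `2` (`not_dvd_level_of_isNewformOf`, so `4 ∤ N`) and rational coefficients
(`IsNewformOf.coeffField_eq_bot`). [folklore] -/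
theorem supersingularLayerCongruence_of_rhombic (hA : RhombicSymbolCongruence) (hR : RhombicOfNegDisc) :
    SupersingularLayerCongruenceAtTwo := by
  intro W _ _ hss hΔ htors N _ f hf
  refine layerCongruence_of_symbolCongruence f (hA f hf.1 hf.coeffField_eq_bot ?_ (hR W hΔ htors f hf))
  intro h4
  exact not_dvd_level_of_isNewformOf hf hss.1 (dvd_trans ⟨2, by norm_num⟩ h4)

end Summit.BirchSwinnertonDyer.Rank1Residual.F1Sign2

end
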